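import Literature.Analysis.FluidPDE.ConvexIntegration2DPotential
import Mathlib.Analysis.Calculus.BumpFunction.InnerProduct
import Mathlib.Analysis.Calculus.BumpFunction.FiniteDimension
import HarnessLib

/-!
# Convex integration in 2-D: localized plane waves, I (data, cutoff, the wave)

Topic `Analysis/FluidPDE`. Support file for the proof of `ConvexIntegrationLemma2DBall`
(Chiodaroli–De Lellis–Kreml 2015, Lemma 3.7 on a ball): CDK 2015, Prop. 4.1 in explicit
two-dimensional form, part I.

* `WaveData`: a space–time ball `B(c, r)` of `ℝ × ℝ²` (sup metric, i.e. the cell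
  `]t₀ - r, t₀ + r[ × B_r(x₀)` on which CDK run their construction), a unit velocity direction
  `n`, the stress parameter `μ` and the amplitude `A`; the frequency vector `η = (-μ, (n₂, -n₁))`
  and the state-space direction `Dvec = (n₁, n₂, 2μn₁n₂, μ(n₂² - n₁²))`;
* `cutoff`: a product of Mathlib bump functions, `= 1` on `B(c, r/2)`, supported in `B(c, r)`;
* `wave d N = pot (A N⁻³ χ cos(N φ_η))` (the localized plane wave: smooth, supported in the
  ball, a classical solution of the linear system, mean zero) and its main term
  `waveMain = A χ sin(Nφ_η) D`.

The `O(1/N)` remainder estimate is in `ConvexIntegration2DPlaneWavesRemainder.lean`, the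
energy/orthogonality asymptotics in `ConvexIntegration2DPlaneWavesEnergy.lean`.

## References

* E. Chiodaroli, C. De Lellis, O. Kreml, *Global ill-posedness of the isentropic system of gas
  dynamics*, Comm. Pure Appl. Math. 68 (2015) 1157–1190, Prop. 4.1 and its proof (§4.2).
-/

noncomputable section

open MeasureTheory Set Metric Filter Function
open scoped ContDiff Topology

namespace Literature.Analysis.FluidPDE.ConvexIntegration

/-! ### Localized plane waves (CDK 2015, Prop. 4.1) -/

/-- Data of a localized plane wave: the space–time ball `B(c, r)` (sup metric, i.e. the cell
`]t₀ - r, t₀ + r[ × B_r(x₀)`), a unit velocity direction `n ∈ ℝ²`, the stress parameter `μ`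
and the amplitude `A`. [cite: ChiodaroliDeLellisKreml2015, Prop. 4.1] -/
structure WaveData where
  /-- centre of the ball -/
  c : ST
  /-- radius of the ball -/
  r : ℝ
  /-- the radius is positive -/
  hr : 0 < r
  /-- velocity direction (a unit vector) -/
  n : E2
  /-- `n` is a unit vector -/
  hn : n 0 ^ 2 + n 1 ^ 2 = 1
  /-- stress parameter (`-` the time frequency) -/
  μ : ℝ
  /-- amplitude -/
  A : ℝ

namespace WaveData

variable (d : WaveData)

/-- The spatial frequency `ξ = (n₂, -n₁)` (so that `ξ^⊥ = n`). [folklore] -/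
def ξ : E2 := !₂[d.n 1, -d.n 0]

/-- The space–time frequency `η = (-μ, ξ)`. [folklore] -/
def η : ST := (-d.μ, d.ξ)

/-- The direction `D = (n₁, n₂, 2μ n₁n₂, μ(n₂² - n₁²))` of the segment in state space
(velocity part `n`, stress part `μ(e ⊗ n + n ⊗ e)` with `e = (n₂, -n₁)`).
[cite: ChiodaroliDeLellisKreml2015, Prop. 4.1 and Lemma 4.3] -/
def Dvec : Fin 4 → ℝ := ![d.n 0, d.n 1, 2 * d.μ * d.n 0 * d.n 1, d.μ * (d.n 1 ^ 2 - d.n 0 ^ 2)]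

/-- `ξ₁ = n₂`. [folklore] -/
theorem ξ_zero : d.ξ 0 = d.n 1 := by simp [ξ]
/-- `ξ₂ = -n₁`. [folklore] -/
theorem ξ_one : d.ξ 1 = -d.n 0 := by simp [ξ]

/-- `φ_η(e₁) = n₂`. [folklore] -/
theorem phaseL_η_dX_zero : phaseL d.η (dX 0) = d.n 1 := by rw [phaseL_dX]; exact d.ξ_zero
/-- `φ_η(e₂) = -n₁`. [folklore] -/
theorem phaseL_η_dX_one : phaseL d.η (dX 1) = -d.n 0 := by rw [phaseL_dX]; exact d.ξ_one
/-- `φ_η(e_t) = -μ`. [folklore] -/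
theorem phaseL_η_dT : phaseL d.η dT = -d.μ := by rw [phaseL_dT]; rfl

/-- The frequency vector is non-zero (its spatial part is a unit vector). [folklore] -/
theorem η_ne_zero : d.η ≠ 0 := by
  intro h
  have h0 : d.ξ 0 = 0 := by
    have : d.ξ = 0 := (Prod.mk_eq_zero.mp h).2
    rw [this]; rfl
  have h1 : d.ξ 1 = 0 := by
    have : d.ξ = 0 := (Prod.mk_eq_zero.mp h).2
    rw [this]; rfl
  rw [ξ_zero] at h0
  rw [ξ_one] at h1
  have := d.hn
  nlinarith

/-- The time bump `χ₀(t)`: `= 1` for `|t - t₀| ≤ r/2`, supported in `|t - t₀| ≤ 3r/4`.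
[folklore] -/
def bumpT : ContDiffBump d.c.1 :=
  ⟨d.r / 2, 3 * d.r / 4, by linarith [d.hr], by linarith [d.hr]⟩

/-- The space bump `χ₁(x)`: `= 1` for `|x - x₀| ≤ r/2`, supported in `|x - x₀| ≤ 3r/4`.
[folklore] -/
def bumpX : ContDiffBump d.c.2 :=
  ⟨d.r / 2, 3 * d.r / 4, by linarith [d.hr], by linarith [d.hr]⟩

/-- The product cutoff `χ(t, x) = χ₀(t) χ₁(x)` adapted to the ball `B(c, r)`. [folklore] -/
def cutoff : ST → ℝ := fun z => d.bumpT z.1 * d.bumpX z.2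

/-- The cutoff is smooth. [folklore] -/
theorem contDiff_cutoff : ContDiff ℝ ∞ d.cutoff :=
  (d.bumpT.contDiff.comp contDiff_fst).mul (d.bumpX.contDiff.comp contDiff_snd)

/-- The cutoff is non-negative. [folklore] -/
theorem cutoff_nonneg (z : ST) : 0 ≤ d.cutoff z := mul_nonneg d.bumpT.nonneg d.bumpX.nonneg

/-- The cutoff is at most `1`. [folklore] -/
theorem cutoff_le_one (z : ST) : d.cutoff z ≤ 1 :=
  mul_le_one₀ d.bumpT.le_one d.bumpX.nonneg d.bumpX.le_one

/-- `|χ| ≤ 1`. [folklore] -/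
theorem abs_cutoff_le_one (z : ST) : |d.cutoff z| ≤ 1 := by
  rw [abs_of_nonneg (d.cutoff_nonneg z)]; exact d.cutoff_le_one z

/-- `χ = 1` on the half ball `B(c, r/2)`. [folklore] -/
theorem cutoff_eq_one {z : ST} (hz : z ∈ ball d.c (d.r / 2)) : d.cutoff z = 1 := by
  rw [mem_ball, Prod.dist_eq, max_lt_iff] at hz
  simp only [cutoff]
  rw [d.bumpT.one_of_mem_closedBall, d.bumpX.one_of_mem_closedBall, mul_one]
  · exact mem_closedBall.mpr hz.2.le
  · exact mem_closedBall.mpr hz.1.le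

/-- The support of `χ` lies in the closed cylinder of radius `3r/4`. [folklore] -/
theorem support_cutoff_subset :
    support d.cutoff ⊆ closedBall d.c.1 (3 * d.r / 4) ×ˢ closedBall d.c.2 (3 * d.r / 4) := by
  intro z hz
  rw [mem_support, cutoff, mul_ne_zero_iff] at hz
  have h1 : z.1 ∈ support d.bumpT := hz.1
  have h2 : z.2 ∈ support d.bumpX := hz.2
  rw [ContDiffBump.support_eq] at h1 h2
  exact ⟨ball_subset_closedBall h1, ball_subset_closedBall h2⟩

/-- `tsupport χ ⊆ closedBall c (3r/4)`. [folklore] -/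
theorem tsupport_cutoff_subset : tsupport d.cutoff ⊆ closedBall d.c (3 * d.r / 4) := by
  rw [← closedBall_prod_same]
  exact closure_minimal d.support_cutoff_subset (isClosed_closedBall.prod isClosed_closedBall)

/-- `tsupport χ ⊆ B(c, r)`. [folklore] -/
theorem tsupport_cutoff_subset_ball : tsupport d.cutoff ⊆ ball d.c d.r :=
  d.tsupport_cutoff_subset.trans (closedBall_subset_ball (by linarith [d.hr]))

/-- The cutoff is compactly supported. [folklore] -/
theorem hasCompactSupport_cutoff : HasCompactSupport d.cutoff :=
  (isCompact_closedBall d.c (3 * d.r / 4)).of_isClosed_subset (isClosed_tsupport _)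
    d.tsupport_cutoff_subset

/-- The scaled amplitude `A N⁻³ χ`. [folklore] -/
def amp (N : ℝ) : ST → ℝ := fun z => d.A / N ^ 3 * d.cutoff z

/-- The potential `g_N = A N⁻³ χ cos(N φ_η)`. [cite: ChiodaroliDeLellisKreml2015, proof of Prop. 4.1] -/
def gpot (N : ℝ) : ST → ℝ := fun z => d.amp N z * osc d.η N 0 z

/-- **The localized plane wave** `pot g_N` with `g_N = A N⁻³ χ cos(Nφ_η)`: a compactly
supported smooth classical solution of the linear system on the ball `B(c, r)`.
[cite: ChiodaroliDeLellisKreml2015, Prop. 4.1] -/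
def wave (N : ℝ) : Fin 4 → ST → ℝ := pot (d.gpot N)

/-- The main term `A χ sin(Nφ_η) D` of the localized plane wave. [folklore] -/
def waveMain (N : ℝ) (i : Fin 4) : ST → ℝ := fun z => d.A * d.cutoff z * osc d.η N 3 z * d.Dvec i

/-- The amplitude is smooth. [folklore] -/
theorem contDiff_amp (N : ℝ) : ContDiff ℝ ∞ (d.amp N) := contDiff_const.mul d.contDiff_cutoff

/-- The potential is smooth. [folklore] -/
theorem contDiff_gpot (N : ℝ) : ContDiff ℝ ∞ (d.gpot N) :=
  (d.contDiff_amp N).mul (contDiff_osc _ _ _)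

/-- The potential is supported in the support of the cutoff. [folklore] -/
theorem tsupport_gpot_subset (N : ℝ) : tsupport (d.gpot N) ⊆ tsupport d.cutoff :=
  (tsupport_mul_subset_left).trans tsupport_mul_subset_right

/-- The potential is compactly supported. [folklore] -/
theorem hasCompactSupport_gpot (N : ℝ) : HasCompactSupport (d.gpot N) :=
  d.hasCompactSupport_cutoff.of_isClosed_subset (isClosed_tsupport _) (d.tsupport_gpot_subset N)

/-- The wave is smooth. [folklore] -/
theorem contDiff_wave (N : ℝ) (i : Fin 4) : ContDiff ℝ ∞ (d.wave N i) :=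
  contDiff_pot (d.contDiff_gpot N) i

/-- The wave is compactly supported. [folklore] -/
theorem hasCompactSupport_wave (N : ℝ) (i : Fin 4) : HasCompactSupport (d.wave N i) :=
  hasCompactSupport_pot (d.hasCompactSupport_gpot N) i

/-- The wave is supported in the ball `B(c, r)` (CDK 2015, Prop. 4.1: `C_c^∞(B₁(0) × ]-1,1[)`, rescaled). [cite: ChiodaroliDeLellisKreml2015, Prop. 4.1] -/
theorem tsupport_wave_subset (N : ℝ) (i : Fin 4) : tsupport (d.wave N i) ⊆ ball d.c d.r :=
  ((tsupport_pot_subset _ i).trans (d.tsupport_gpot_subset N)).trans d.tsupport_cutoff_subset_ball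

/-- The wave vanishes off the ball. [folklore] -/
theorem wave_eq_zero {N : ℝ} {i : Fin 4} {z : ST} (hz : z ∉ ball d.c d.r) : d.wave N i z = 0 :=
  image_eq_zero_of_notMem_tsupport fun h => hz (d.tsupport_wave_subset N i h)

/-- The wave solves the linear system (CDK 2015, Prop. 4.1, (4.1)). [cite: ChiodaroliDeLellisKreml2015, Prop. 4.1] -/
theorem solvesLinear_wave (N : ℝ) : SolvesLinear (d.wave N) := solvesLinear_pot (d.contDiff_gpot N)

/-- The wave has vanishing mean (CDK 2015, Prop. 4.1 (i): `∫ (v,u) = 0`). [cite: ChiodaroliDeLellisKreml2015, Prop. 4.1 (i)] -/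
theorem integral_wave_eq_zero (N : ℝ) (i : Fin 4) : ∫ z, d.wave N i z = 0 :=
  integral_pot_eq_zero (d.contDiff_gpot N) (d.hasCompactSupport_gpot N) i



end WaveData

end Literature.Analysis.FluidPDE.ConvexIntegration
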